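import Summits.CriticalPhenomena.CardyFormulaZ2.Theses.CardyBoundaryCoulombGas
import Summits.CriticalPhenomena.CardyFormulaZ2.Theorems.CardyBoundaryCoulombGasStripClusterRatesTwoClusterDictionaryStep
import Summits.CriticalPhenomena.CardyFormulaZ2.Theorems.CardyBoundaryCoulombGasStripClusterRatesTwoClusterDictionaryEvent
import Summits.CriticalPhenomena.CardyFormulaZ2.Theorems.CardyBoundaryCoulombGasStripClusterRatesTwoClusterDictionaryCount
import Literature.Probability.LatticeModels.RowStatePlanar
import Literature.Probability.Percolation.LatticeSymmetry
import Literature.Probability.Percolation.FiniteEnergy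
import Literature.Probability.Percolation.RSW

/-!
# Stub D3 `stub_twoClusterDictionary`: two distinct spanning clusters ≍ coupling disagreement

Registered stub of the line `two-cluster-rate-is-stationary-gap` of crux
`CardyBoundaryCoulombGas.StripClusterRates` (stmt-CriticalPhenomena-13878), skeleton
`Cruxes/StripClusterRates/Lines/two-cluster-rate-is-stationary-gap.lean` (`TwoClusterDictionary`).

For every width `n ≥ 1` there is `c > 0` (here `c = 2^{-n}`) with, for every length `m`,
`c · dis n m ≤ p₂(m,n) ≤ dis n m`, where `p₂(m,n) = P_{1/2}`[two open left–right crossings of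
`[0,m] × [0,n]` in distinct open clusters of the rectangle] and `dis n m` is the fraction of admissible
bond sequences of the planar `⋆`-chain (`RowStatePlanar.lean`) on which the iterates from ALLJOINED
(`planarRowStep univ (hEdges S) free`: all sites joined, `⋆` apart) and from FREE disagree.

Proof (grand coupling). Read the bonds of `ω` along the rectangle (`d3_count`: under `P_{1/2}` the
read sequence is uniform, so `P[iter ALLJOINED ≠ iter FREE] = dis n m`). Pathwise, for lattice
configurations (`ae_subset_edgeSet`): the iterate from the random free start `F₀(ω)` (column `0`
partitioned by its own open vertical edges) encodes `ω`-connectivity of the last column inside the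
rectangle, and the iterate from ALLJOINED `= F₀(ω ∪ V₀)` encodes `(ω ∪ V₀)`-connectivity, `V₀` = the
vertical edges of the left side (`d3_dictionary`, twice); hence the two-cluster event is EXACTLY
`{iter ALLJOINED ≠ iter F₀(ω)}` (`d3_twoCluster_iff`). Monotonicity of the coupling in the start
(`FREE ≤ F₀(ω) ≤ ALLJOINED`, `d3_foldl_sandwich`) gives the upper bound; on `{V₀ closed}` the free
start IS `FREE`, and `{V₀ closed}` is independent of the read edges
(`bondPercolation_real_inter_of_disjoint`) with probability `≥ 2^{-n}`
(`le_bondPercolation_real_forall_notMem`), which gives the lower bound.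

Sources: Levin–Peres–Wilmer (2009) §5 (grand coupling); Bondesan–Jacobsen–Saleur (2013) §2;
Grimmett, *Percolation* (1999) §1.3, §2.2.
-/

noncomputable section

namespace Summit.CriticalPhenomena.CardyFormulaZ2.Cruxes.StripClusterRates.TwoClusterRateIsStationaryGap

open Filter Topology MeasureTheory
open scoped BigOperators Classical
open Literature.Probability.Percolation Literature.Probability.LatticeModels

/-- One row step is monotone in the state (refinement order of the partitions). -/
theorem d3_rowStep_mono {S : Finset ℤ} (O H : Finset S) {π ρ : RowState S} (h : π.rel ≤ ρ.rel) :
    (rowStep O H π).rel ≤ (rowStep O H ρ).rel :=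
  sup_le_sup_right (vertRel_mono O h) _

/-- Opening more horizontal bonds in a row step gives a coarser state. -/
theorem d3_rowStep_mono_right {S : Finset ℤ} (O : Finset S) {H H' : Finset S} (hH : H ⊆ H')
    (π : RowState S) : (rowStep O H π).rel ≤ (rowStep O H' π).rel :=
  sup_le_sup_left (Finset.sup_mono hH) _

/-- Iterated row steps (the grand coupling: the same bonds for every start) are monotone in the
initial state. -/
theorem d3_foldl_mono {S : Finset ℤ} (l : List (Finset S × Finset S)) {p q : PlanarRowState S}
    (h : p.1.rel ≤ q.1.rel) :
    (l.foldl (fun r OH => planarRowStep OH.1 OH.2 r) p).1.rel ≤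
      (l.foldl (fun r OH => planarRowStep OH.1 OH.2 r) q).1.rel := by
  induction l generalizing p q with
  | nil => exact h
  | cons OH l ih => exact ih (d3_rowStep_mono OH.1 OH.2 h)

/-- Sandwich for the grand coupling: if the iterates from the bottom start `p` and the top start `r`
agree, so does the iterate from any start `q` in between. -/
theorem d3_foldl_sandwich {S : Finset ℤ} (l : List (Finset S × Finset S)) {p q r : PlanarRowState S}
    (hpq : p.1.rel ≤ q.1.rel) (hqr : q.1.rel ≤ r.1.rel)
    (h : l.foldl (fun r OH => planarRowStep OH.1 OH.2 r) r =
      l.foldl (fun r OH => planarRowStep OH.1 OH.2 r) p) :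
    l.foldl (fun r OH => planarRowStep OH.1 OH.2 r) r =
      l.foldl (fun r OH => planarRowStep OH.1 OH.2 r) q := by
  apply Subtype.ext
  apply RowState.ext
  refine le_antisymm ?_ (d3_foldl_mono l hqr)
  rw [h]
  exact d3_foldl_mono l hpq

/-- **Locality.** The event that the bond sequence read off `[0,m] × [0,n]` has a property `pred` is
determined by a finite set of lattice edges each having an endpoint off the column `x = 0` (so it is
measurable and independent of the vertical edges of the left side). -/
theorem d3_determined (n m : ℕ)
    (pred : (Fin m → Finset (Finset.Icc (0 : ℤ) n) × Finset (Finset.Icc (0 : ℤ) n)) → Prop) :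
    ∃ E : Finset (Sym2 (Site 2)), (∀ e ∈ E, ∃ u ∈ e, u 0 ≠ 0) ∧
      DeterminedBy {ω : BondConfig (Site 2) | pred fun i : Fin m =>
        (Finset.univ.filter fun y : Finset.Icc (0 : ℤ) n =>
            s(![((i : ℕ) : ℤ), (y : ℤ)], ![((i : ℕ) : ℤ) + 1, (y : ℤ)]) ∈ ω,
          (hEdges (Finset.Icc (0 : ℤ) n)).filter fun y =>
            s(![((i : ℕ) : ℤ) + 1, (y : ℤ)], ![((i : ℕ) : ℤ) + 1, (y : ℤ) + 1]) ∈ ω)} ↑E := by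
  set hE : Fin m → Finset.Icc (0 : ℤ) n → Sym2 (Site 2) :=
    fun i y => s(![((i : ℕ) : ℤ), (y : ℤ)], ![((i : ℕ) : ℤ) + 1, (y : ℤ)]) with hhE
  set vE : Fin m → Finset.Icc (0 : ℤ) n → Sym2 (Site 2) :=
    fun i y => s(![((i : ℕ) : ℤ) + 1, (y : ℤ)], ![((i : ℕ) : ℤ) + 1, (y : ℤ) + 1]) with hvE
  refine ⟨Finset.univ.biUnion fun i => Finset.univ.image (hE i) ∪ Finset.univ.image (vE i), ?_, ?_⟩
  · intro e he
    simp only [Finset.mem_biUnion, Finset.mem_univ, true_and, Finset.mem_union, Finset.mem_image] at he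
    obtain ⟨i, ⟨y, rfl⟩ | ⟨y, rfl⟩⟩ := he
    · exact ⟨![((i : ℕ) : ℤ) + 1, (y : ℤ)], Sym2.mem_mk_right _ _, by simp; omega⟩
    · exact ⟨![((i : ℕ) : ℤ) + 1, (y : ℤ)], Sym2.mem_mk_left _ _, by simp; omega⟩
  · rw [determinedBy_iff]
    intro ω ω' h
    have key : ∀ e ∈ (Finset.univ.biUnion fun i => Finset.univ.image (hE i) ∪ Finset.univ.image (vE i)),
        e ∈ ω ↔ e ∈ ω' := fun e he =>
      ⟨fun h1 => ((Set.ext_iff.1 h e).1 ⟨h1, he⟩).1, fun h1 => ((Set.ext_iff.1 h e).2 ⟨h1, he⟩).1⟩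
    have hmemh : ∀ i y, hE i y ∈ ω ↔ hE i y ∈ ω' := fun i y => key _ (by
      simp only [Finset.mem_biUnion, Finset.mem_univ, true_and, Finset.mem_union, Finset.mem_image]
      exact ⟨i, Or.inl ⟨y, rfl⟩⟩)
    have hmemv : ∀ i y, vE i y ∈ ω ↔ vE i y ∈ ω' := fun i y => key _ (by
      simp only [Finset.mem_biUnion, Finset.mem_univ, true_and, Finset.mem_union, Finset.mem_image]
      exact ⟨i, Or.inr ⟨y, rfl⟩⟩)
    simp only [Set.mem_setOf_eq]
    have hs : (fun i : Fin m => (Finset.univ.filter fun y => hE i y ∈ ω,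
        (hEdges (Finset.Icc (0 : ℤ) n)).filter fun y => vE i y ∈ ω)) =
        fun i : Fin m => (Finset.univ.filter fun y => hE i y ∈ ω',
          (hEdges (Finset.Icc (0 : ℤ) n)).filter fun y => vE i y ∈ ω') := by
      funext i
      refine Prod.ext ?_ ?_
      · exact Finset.filter_congr fun y _ => hmemh i y
      · exact Finset.filter_congr fun y _ => hmemv i y
    rw [hs]

/-- **D3 · two-cluster dictionary** (`= TwoClusterDictionary` of the line skeleton): the crux's
two-distinct-spanning-clusters probability `p₂(m,n)` is two-sided comparable, uniformly in `m`, with the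
disagreement fraction of the grand coupling of the planar `⋆`-chain started from ALLJOINED and FREE. -/
theorem stub_twoClusterDictionary :
    ∀ n : ℕ, 1 ≤ n → ∃ c : ℝ, 0 < c ∧ ∀ m : ℕ,
      c * ((((Fintype.piFinset fun _ : Fin m =>
              (Finset.univ : Finset (Finset (Finset.Icc (0 : ℤ) n))) ×ˢ (hEdges (Finset.Icc (0 : ℤ) n)).powerset).filter
            fun seq =>
              (List.ofFn seq).foldl (fun r OH => planarRowStep OH.1 OH.2 r)
                  (planarRowStep Finset.univ (hEdges (Finset.Icc (0 : ℤ) n))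
                    ⟨RowState.free (Finset.Icc (0 : ℤ) n), RowState.isPlanar_free (Finset.Icc (0 : ℤ) n)⟩) ≠
                (List.ofFn seq).foldl (fun r OH => planarRowStep OH.1 OH.2 r)
                  ⟨RowState.free (Finset.Icc (0 : ℤ) n), RowState.isPlanar_free (Finset.Icc (0 : ℤ) n)⟩).card : ℝ) /
          ((2 : ℝ) ^ (Finset.Icc (0 : ℤ) n).card * 2 ^ (hEdges (Finset.Icc (0 : ℤ) n)).card) ^ m)
        ≤ (bondPercolation (zdGraph 2) half).real
          {ω | ∃ x₁ ∈ (leftSide m n : Set (Site 2)), ∃ y₁ ∈ (rightSide m n : Set (Site 2)),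
            ∃ x₂ ∈ (leftSide m n : Set (Site 2)), ∃ y₂ ∈ (rightSide m n : Set (Site 2)),
              ω ∈ openConnIn (rectangle m n : Set (Site 2)) x₁ y₁ ∧
              ω ∈ openConnIn (rectangle m n : Set (Site 2)) x₂ y₂ ∧
              ω ∉ openConnIn (rectangle m n : Set (Site 2)) x₁ x₂} ∧
      (bondPercolation (zdGraph 2) half).real
          {ω | ∃ x₁ ∈ (leftSide m n : Set (Site 2)), ∃ y₁ ∈ (rightSide m n : Set (Site 2)),
            ∃ x₂ ∈ (leftSide m n : Set (Site 2)), ∃ y₂ ∈ (rightSide m n : Set (Site 2)),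
              ω ∈ openConnIn (rectangle m n : Set (Site 2)) x₁ y₁ ∧
              ω ∈ openConnIn (rectangle m n : Set (Site 2)) x₂ y₂ ∧
              ω ∉ openConnIn (rectangle m n : Set (Site 2)) x₁ x₂}
        ≤ ((((Fintype.piFinset fun _ : Fin m =>
              (Finset.univ : Finset (Finset (Finset.Icc (0 : ℤ) n))) ×ˢ (hEdges (Finset.Icc (0 : ℤ) n)).powerset).filter
            fun seq =>
              (List.ofFn seq).foldl (fun r OH => planarRowStep OH.1 OH.2 r)
                  (planarRowStep Finset.univ (hEdges (Finset.Icc (0 : ℤ) n))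
                    ⟨RowState.free (Finset.Icc (0 : ℤ) n), RowState.isPlanar_free (Finset.Icc (0 : ℤ) n)⟩) ≠
                (List.ofFn seq).foldl (fun r OH => planarRowStep OH.1 OH.2 r)
                  ⟨RowState.free (Finset.Icc (0 : ℤ) n), RowState.isPlanar_free (Finset.Icc (0 : ℤ) n)⟩).card : ℝ) /
          ((2 : ℝ) ^ (Finset.Icc (0 : ℤ) n).card * 2 ^ (hEdges (Finset.Icc (0 : ℤ) n)).card) ^ m) := by
  intro n _hn
  -- the vertical edges of the left side (column `0`)
  set V₀ : Finset (Sym2 (Site 2)) :=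
    (Finset.range n).image fun k : ℕ => s(![0, (k : ℤ)], ![0, (k : ℤ) + 1]) with hV₀
  refine ⟨(1 - ((half : unitInterval) : ℝ)) ^ V₀.card, pow_pos (by rw [coe_half]; norm_num) _,
    fun m => ?_⟩
  -- the chain: starts, steps, the reading of `ω`, the disagreement predicate
  set FREE : PlanarRowState (Finset.Icc (0 : ℤ) n) :=
    ⟨RowState.free (Finset.Icc (0 : ℤ) n), RowState.isPlanar_free (Finset.Icc (0 : ℤ) n)⟩ with hFREE
  set ALL : PlanarRowState (Finset.Icc (0 : ℤ) n) :=
    planarRowStep Finset.univ (hEdges (Finset.Icc (0 : ℤ) n)) FREE with hALL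
  set step : PlanarRowState (Finset.Icc (0 : ℤ) n) →
      Finset (Finset.Icc (0 : ℤ) n) × Finset (Finset.Icc (0 : ℤ) n) → PlanarRowState (Finset.Icc (0 : ℤ) n) :=
    fun r OH => planarRowStep OH.1 OH.2 r with hstep
  set pred : (Fin m → Finset (Finset.Icc (0 : ℤ) n) × Finset (Finset.Icc (0 : ℤ) n)) → Prop :=
    fun seq => (List.ofFn seq).foldl step ALL ≠ (List.ofFn seq).foldl step FREE with hpred
  set seqOf : BondConfig (Site 2) → ℕ → Finset (Finset.Icc (0 : ℤ) n) × Finset (Finset.Icc (0 : ℤ) n) :=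
    fun ω t => (Finset.univ.filter fun y => s(![(t : ℤ), (y : ℤ)], ![(t : ℤ) + 1, (y : ℤ)]) ∈ ω,
      (hEdges (Finset.Icc (0 : ℤ) n)).filter fun y =>
        s(![(t : ℤ) + 1, (y : ℤ)], ![(t : ℤ) + 1, (y : ℤ) + 1]) ∈ ω) with hseqOf
  set H₀ : BondConfig (Site 2) → Finset (Finset.Icc (0 : ℤ) n) :=
    fun ω => (hEdges (Finset.Icc (0 : ℤ) n)).filter fun y => s(![0, (y : ℤ)], ![0, (y : ℤ) + 1]) ∈ ω with hH₀
  set A : Set (BondConfig (Site 2)) :=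
    {ω | ∃ x₁ ∈ (leftSide m n : Set (Site 2)), ∃ y₁ ∈ (rightSide m n : Set (Site 2)),
      ∃ x₂ ∈ (leftSide m n : Set (Site 2)), ∃ y₂ ∈ (rightSide m n : Set (Site 2)),
        ω ∈ openConnIn (rectangle m n : Set (Site 2)) x₁ y₁ ∧
        ω ∈ openConnIn (rectangle m n : Set (Site 2)) x₂ y₂ ∧
        ω ∉ openConnIn (rectangle m n : Set (Site 2)) x₁ x₂} with hA
  set D : Set (BondConfig (Site 2)) := {ω | pred fun i : Fin m => seqOf ω i} with hD
  set Z : Set (BondConfig (Site 2)) := {ω | ∀ e ∈ V₀, e ∉ ω} with hZ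
  set total : ℝ := ((2 : ℝ) ^ (Finset.Icc (0 : ℤ) n).card * 2 ^ (hEdges (Finset.Icc (0 : ℤ) n)).card) ^ m
    with htotal
  set seqs := Fintype.piFinset fun _ : Fin m =>
    (Finset.univ : Finset (Finset (Finset.Icc (0 : ℤ) n))) ×ˢ (hEdges (Finset.Icc (0 : ℤ) n)).powerset
    with hseqs
  change (1 - ((half : unitInterval) : ℝ)) ^ V₀.card * (((seqs.filter pred).card : ℝ) / total) ≤
      (bondPercolation (zdGraph 2) half).real A ∧
    (bondPercolation (zdGraph 2) half).real A ≤ ((seqs.filter pred).card : ℝ) / total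
  -- (1) counting: `P(D) = dis n m`
  have hcount : (bondPercolation (zdGraph 2) half).real D = ((seqs.filter pred).card : ℝ) / total :=
    d3_count n m pred
  -- (2) locality: `D` is a cylinder event over edges off column `0`, independent of `Z`
  obtain ⟨E, hE0, hdet⟩ := d3_determined n m pred
  change DeterminedBy D ↑E at hdet
  have hDm : MeasurableSet D := hdet.measurableSet_of_finset
  have hZdet : DeterminedBy Z ↑V₀ := determinedBy_forall_notMem V₀
  have hZm : MeasurableSet Z := measurableSet_forall_notMem V₀
  have hdisj : Disjoint (↑V₀ : Set (Sym2 (Site 2))) ↑E := by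
    rw [Finset.disjoint_coe, Finset.disjoint_left]
    intro e heV heE
    obtain ⟨u, hu, hu0⟩ := hE0 e heE
    simp only [hV₀, Finset.mem_image, Finset.mem_range] at heV
    obtain ⟨k, -, rfl⟩ := heV
    rcases Sym2.mem_iff.1 hu with rfl | rfl <;> simp at hu0
  have hZD : (bondPercolation (zdGraph 2) half).real (Z ∩ D) =
      (bondPercolation (zdGraph 2) half).real Z * (bondPercolation (zdGraph 2) half).real D :=
    bondPercolation_real_inter_of_disjoint (zdGraph 2) half hdisj hZdet hdet hZm hDm
  have hPZ : (1 - ((half : unitInterval) : ℝ)) ^ V₀.card ≤ (bondPercolation (zdGraph 2) half).real Z :=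
    le_bondPercolation_real_forall_notMem (zdGraph 2) half V₀
  -- (3) the left-side vertical edges
  have hV₀E : (↑V₀ : Set (Sym2 (Site 2))) ⊆ (zdGraph 2).edgeSet := by
    intro e he
    simp only [hV₀, Finset.coe_image, Finset.coe_range, Set.mem_image, Set.mem_Iio] at he
    obtain ⟨k, -, rfl⟩ := he
    rw [SimpleGraph.mem_edgeSet, zdGraph_two_adj_iff]
    right; right; left
    simp
  have hV₀0 : ∀ u w : Site 2, s(u, w) ∈ (↑V₀ : Set (Sym2 (Site 2))) → u 0 = 0 ∧ w 0 = 0 := by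
    intro u w h
    simp only [hV₀, Finset.coe_image, Finset.coe_range, Set.mem_image, Set.mem_Iio] at h
    obtain ⟨k, -, hk⟩ := h
    rw [Sym2.eq_iff] at hk
    rcases hk with ⟨rfl, rfl⟩ | ⟨rfl, rfl⟩ <;> simp
  have hV₀V : ∀ y : ℤ, 0 ≤ y → y + 1 ≤ n → s(![0, y], ![0, y + 1]) ∈ (↑V₀ : Set (Sym2 (Site 2))) := by
    intro y hy hyn
    simp only [hV₀, Finset.coe_image, Finset.coe_range, Set.mem_image, Set.mem_Iio]
    exact ⟨y.toNat, by omega, by rw [Int.toNat_of_nonneg hy]⟩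
  have hIcc : ∀ y : Finset.Icc (0 : ℤ) n, (y : ℤ) + 1 ∈ Finset.Icc (0 : ℤ) n ↔ (y : ℤ) + 1 ≤ n := by
    intro y
    have := Finset.mem_Icc.1 y.2
    rw [Finset.mem_Icc]
    omega
  -- (4) pathwise event identity: `A = {iter ALL ≠ iter F₀(ω)}` on lattice configurations
  have key : ∀ ω : BondConfig (Site 2), ω ⊆ (zdGraph 2).edgeSet →
      (ω ∈ A ↔ (List.ofFn fun i : Fin m => seqOf ω i).foldl step ALL ≠
        (List.ofFn fun i : Fin m => seqOf ω i).foldl step (planarRowStep Finset.univ (H₀ ω) FREE)) := by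
    intro ω hω
    have hX := d3_dictionary n ω hω (seqOf ω) (fun t y => by simp [hseqOf])
      (fun t y => by simp only [hseqOf, Finset.mem_filter, mem_hEdges, hIcc]) (H₀ ω)
      (fun y => by simp only [hH₀, Finset.mem_filter, mem_hEdges, hIcc]) m
    have hωp : ω ∪ ↑V₀ ⊆ (zdGraph 2).edgeSet := Set.union_subset hω hV₀E
    have hY := d3_dictionary n (ω ∪ ↑V₀) hωp (seqOf ω) (fun t y => ?_) (fun t y => ?_)
      (hEdges (Finset.Icc (0 : ℤ) n)) (fun y => ?_) m
    · exact d3_twoCluster_iff m n ω ↑V₀ hω hV₀E hV₀0 hV₀V _ _ hX.1 hX.2 hY.1 hY.2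
    · simp only [hseqOf, Finset.mem_filter, Finset.mem_univ, true_and, Set.mem_union, iff_self_or]
      intro h
      have := (hV₀0 _ _ h).2
      simp at this
      omega
    · simp only [hseqOf, Finset.mem_filter, mem_hEdges, hIcc, Set.mem_union]
      constructor
      · rintro ⟨h1, h2⟩
        exact ⟨h1, Or.inl h2⟩
      · rintro ⟨h1, h2 | h2⟩
        · exact ⟨h1, h2⟩
        · have := (hV₀0 _ _ h2).1
          simp at this
          omega
    · rw [mem_hEdges, hIcc, Set.mem_union]
      have := Finset.mem_Icc.1 y.2
      exact ⟨fun h => ⟨h, Or.inr (hV₀V _ this.1 h)⟩, fun h => h.1⟩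
  -- (5) monotonicity of the grand coupling in the start: `FREE ≤ F₀(ω) ≤ ALL`
  have hFle : ∀ ω, FREE.1.rel ≤ (planarRowStep Finset.univ (H₀ ω) FREE).1.rel := fun ω => bot_le
  have hleA : ∀ ω, (planarRowStep Finset.univ (H₀ ω) FREE).1.rel ≤ ALL.1.rel := fun ω =>
    d3_rowStep_mono_right _ (Finset.filter_subset _ _) _
  have hAD : ∀ ω : BondConfig (Site 2), ω ⊆ (zdGraph 2).edgeSet → ω ∈ A → ω ∈ D := by
    intro ω hω hωA h2
    exact (key ω hω).1 hωA (d3_foldl_sandwich _ (hFle ω) (hleA ω) h2)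
  have hZDA : ∀ ω : BondConfig (Site 2), ω ⊆ (zdGraph 2).edgeSet → ω ∈ Z ∩ D → ω ∈ A := by
    rintro ω hω ⟨hωZ, hωD⟩
    have hH0 : H₀ ω = ∅ := by
      simp only [hH₀, Finset.filter_eq_empty_iff, mem_hEdges, hIcc]
      intro y hy he
      exact hωZ _ (Finset.mem_coe.1 (hV₀V _ (Finset.mem_Icc.1 y.2).1 hy)) he
    refine (key ω hω).2 ?_
    have h0 : planarRowStep Finset.univ (H₀ ω) FREE = FREE := by
      rw [hH0]
      exact Subtype.ext (rowStep_univ_empty _)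
    rw [h0]
    exact hωD
  -- (6) assemble
  have hPAD : (bondPercolation (zdGraph 2) half).real A ≤ (bondPercolation (zdGraph 2) half).real D := by
    refine ENNReal.toReal_mono (measure_ne_top _ _) (measure_mono_ae ?_)
    filter_upwards [ae_subset_edgeSet (zdGraph 2) half] with ω hω hωA using hAD ω hω hωA
  have hPZDA : (bondPercolation (zdGraph 2) half).real (Z ∩ D) ≤ (bondPercolation (zdGraph 2) half).real A := by
    refine ENNReal.toReal_mono (measure_ne_top _ _) (measure_mono_ae ?_)
    filter_upwards [ae_subset_edgeSet (zdGraph 2) half] with ω hω hωZD using hZDA ω hω hωZD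
  constructor
  · calc (1 - ((half : unitInterval) : ℝ)) ^ V₀.card * (((seqs.filter pred).card : ℝ) / total)
        = (1 - ((half : unitInterval) : ℝ)) ^ V₀.card * (bondPercolation (zdGraph 2) half).real D := by
          rw [hcount]
      _ ≤ (bondPercolation (zdGraph 2) half).real Z * (bondPercolation (zdGraph 2) half).real D :=
          mul_le_mul_of_nonneg_right hPZ measureReal_nonneg
      _ = (bondPercolation (zdGraph 2) half).real (Z ∩ D) := hZD.symm
      _ ≤ (bondPercolation (zdGraph 2) half).real A := hPZDA
  · calc (bondPercolation (zdGraph 2) half).real A ≤ (bondPercolation (zdGraph 2) half).real D := hPAD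
      _ = ((seqs.filter pred).card : ℝ) / total := hcount

end Summit.CriticalPhenomena.CardyFormulaZ2.Cruxes.StripClusterRates.TwoClusterRateIsStationaryGap
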